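import Literature.Computability.QuantumComplexity.ReversibleCliffordT
import HarnessLib

/-!
# The controlled-`S†` gate as an exact Clifford+T word

Topic `Literature/Computability/QuantumComplexity`. The controlled phase `diag(1, 1, 1, −i)` on two
wires `(τ, c)` — "multiply by `−i` iff both are set" — as an 11-gate word over `{H, S, T, CNOT}`:
`T†_c T†_τ · CNOT(τ,c) T_c CNOT(τ,c)` with `T† = T S³`, the standard `T`-count-3 synthesis of a
controlled phase (Nielsen–Chuang 2010, §4.3; the phases are `ω^{7c + 7τ + (c ⊕ τ)}`, `ω = e^{iπ/4}`,
i.e. `1, 1, 1, ω⁶ = −i`). Used by the cubic Gauss-sum block to switch Kitaev's sine test on the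
control qubit by a coin wire (`VanDamSeroussiCubicBlock.lean`).

* `csdWord τ c h` — the word; `csdWord_isOracleFree`;
* **`csdWord_mulVec_basisState`** — `|w⟩ ↦ (−i)^{w τ ∧ w c} |w⟩`.

Everything here is proved; no named fact is introduced.

## References

* M. A. Nielsen, I. L. Chuang, *Quantum Computation and Quantum Information*, CUP 2010, §4.2
  (`S`, `T`), §4.3 (controlled phase gates from `CNOT` and `T`) [NielsenChuang2010].
-/

noncomputable section

namespace Literature.Computability.QuantumComplexity

open Cryptography Matrix

variable {N : ℕ}

/-- **The controlled-`S†` word** on control `τ` and target `c`. [cite: NielsenChuang2010, §4.3] -/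
def csdWord (τ c : Fin N) (h : τ ≠ c) : List (QGate cliffordT N) :=
  [tOn c, sOn c, sOn c, sOn c, tOn τ, sOn τ, sOn τ, sOn τ, cnotOn τ c h, tOn c, cnotOn τ c h]

/-- The word is oracle-free. [folklore] -/
theorem csdWord_isOracleFree (τ c : Fin N) (h : τ ≠ c) : ∀ g ∈ csdWord τ c h, g.IsOracleFree := by
  intro g hg
  simp only [csdWord, List.mem_cons, List.not_mem_nil, or_false] at hg
  rcases hg with rfl | rfl | rfl | rfl | rfl | rfl | rfl | rfl | rfl | rfl | rfl <;>
    first | exact tOn_isOracleFree _ | exact sOn_isOracleFree _ | exact cnotOn_isOracleFree _ _ _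

/-- `T S³ = T†` on a wire: `|w⟩ ↦ ω^{7 w_i} |w⟩`, i.e. the phase `ω⁷ = conj ω` when `w i`. [cite: NielsenChuang2010, §4.2] -/
theorem tsss_mulVec_basisState (i : Fin N) (w : QReg N) :
    (⟨[tOn i, sOn i, sOn i, sOn i]⟩ : QCircuit cliffordT N).toMatrix 0 *ᵥ basisState w =
      (if w i then omega ^ 7 else 1) • basisState w := by
  rw [QCircuit.toMatrix_cons, QCircuit.toMatrix_cons, QCircuit.toMatrix_cons, QCircuit.toMatrix_cons, QCircuit.toMatrix_nil,
    Matrix.one_mul, ← Matrix.mulVec_mulVec, ← Matrix.mulVec_mulVec, ← Matrix.mulVec_mulVec, tOn_mulVec_basisState,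
    Matrix.mulVec_smul, sOn_mulVec_basisState, smul_smul, Matrix.mulVec_smul, sOn_mulVec_basisState, smul_smul,
    Matrix.mulVec_smul, sOn_mulVec_basisState, smul_smul]
  congr 1
  cases w i
  · simp
  · simp only [if_true]
    have h8 := omega_pow_eight
    have h2 := omega_pow_two
    -- `i³ ω = ω⁶ ω = ω⁷`
    calc omega * Complex.I * Complex.I * Complex.I = (omega ^ 2) ^ 3 * omega := by rw [h2]; ring
      _ = omega ^ 7 := by ring

/-- **The controlled-`S†` word multiplies `|w⟩` by `−i` iff `w τ` and `w c`.** [cite: NielsenChuang2010, §4.3] -/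
theorem csdWord_mulVec_basisState (τ c : Fin N) (h : τ ≠ c) (w : QReg N) :
    (⟨csdWord τ c h⟩ : QCircuit cliffordT N).toMatrix 0 *ᵥ basisState w =
      (if w τ ∧ w c then -Complex.I else 1) • basisState w := by
  have hsplit : (⟨csdWord τ c h⟩ : QCircuit cliffordT N) =
      ((⟨[tOn c, sOn c, sOn c, sOn c]⟩ : QCircuit cliffordT N).append ⟨[tOn τ, sOn τ, sOn τ, sOn τ]⟩).append
        ⟨[cnotOn τ c h, tOn c, cnotOn τ c h]⟩ := rfl
  have hlast : (⟨[cnotOn τ c h, tOn c, cnotOn τ c h]⟩ : QCircuit cliffordT N).toMatrix 0 *ᵥ basisState w =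
      (if (w c ^^ w τ) then omega else 1) • basisState w := by
    rw [QCircuit.toMatrix_cons, QCircuit.toMatrix_cons, QCircuit.toMatrix_cons, QCircuit.toMatrix_nil, Matrix.one_mul,
      ← Matrix.mulVec_mulVec, ← Matrix.mulVec_mulVec, cnotOn_mulVec_basisState, tOn_mulVec_basisState, Matrix.mulVec_smul,
      cnotOn_mulVec_basisState, Function.update_self, Function.update_idem, Function.update_of_ne h,
      show ((w c ^^ w τ) ^^ w τ) = w c by cases w c <;> cases w τ <;> rfl, Function.update_eq_self]
  rw [hsplit, QCircuit.toMatrix_append, QCircuit.toMatrix_append, ← Matrix.mulVec_mulVec, ← Matrix.mulVec_mulVec,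
    tsss_mulVec_basisState, Matrix.mulVec_smul, tsss_mulVec_basisState, Matrix.mulVec_smul, Matrix.mulVec_smul, hlast,
    smul_smul, smul_smul]
  congr 1
  have h8 := omega_pow_eight
  have h2 := omega_pow_two
  have h4 := omega_pow_four
  cases w τ <;> cases w c <;> simp
  · -- `c` only: `ω⁷ · ω = 1`
    calc omega ^ 7 * omega = omega ^ 8 := by ring
      _ = 1 := h8
  · -- `τ` only
    calc omega ^ 7 * omega = omega ^ 8 := by ring
      _ = 1 := h8
  · -- both: `ω⁷ ω⁷ = ω^{14} = ω⁶ = −i`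
    calc omega ^ 7 * omega ^ 7 = omega ^ 8 * (omega ^ 4 * omega ^ 2) := by ring
      _ = -Complex.I := by rw [h8, h4, h2]; ring

end Literature.Computability.QuantumComplexity
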